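import Summits.QuantumFields.YangMills.Theorems.BalabanUVNodesN07KnitTokensLandauTwoOfRows
import Summits.QuantumFields.YangMills.Theorems.BalabanUVNodesN07HessOpOfRecordSymmetric
import HarnessLib

/-!
# N07 — THE LANDAU ROW OF `H₁` AT THE RECORD ((45) 2nd row ∕ [B9] (3.124)′): `RD*(H₁B) = 0` for the slot-(c) reader `H1OfRecordAt … Δ₁ …` whenever `Δ₁` is symmetric and kills the
# `N(Q′)` gauge modes — hence «`RD*(S.𝔄 V) = 0`» (the row RR-2 named `H1LandauTok`) and THE F-H ROW «`RD*(Emap H C ε A′) = 0`» FOR EVERY `π`-TYPE CHART `H := H1OfRecordAtBg128 … G′ Δ⁽²⁾′ …`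
# (in particular print's `H_π`, `Δ⁽²⁾′ = 0`), from def-Y's G′-datum rows (g5), (g2) — lit ✓`h124'_RLatticeK` read at the record

Cell `pub-ymgap`, seat `pub-ymgap-dag-n07-w3` (g29, WIDTH SEAT 3 on N07 [B11] = [15]); helper file keyed `--kind proof --supports stmt-QuantumFields-27238 --as helper` (K0ᴬ road);
count-neutral.  INTENT-13 of the seat.  This is the tool that makes def-Y's F-H re-key CLOSE: with `H_π` in the chart and `W`-slot, the two Landau rows displayed by
✓`knitTokens_landau_two_of_rows_real` ∕ ✓`minTokens_landau_of_rows` become §2's theorems (modulo (g5), (g2) — the rows behind `FrakGSliceTok` — and symmetry of `Δ₁`).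

## What is here

* §1 ★★ `RDstar_iota_H1OfRecordAt_eq_zero` — for ANY symmetric `Δ₁` killing the `N(Q′♭)` gauge modes (g1) and with `Q(U₀)` killing them (g2): `R_r(D†(ι(H₁B))) = 0`
  (`H₁ = G₁Q†(QG₁Q†)⁻¹`: lit ✓`H1LatticeK_eq` + ✓`h124'_RLatticeK`, the record's `conj c = c` ∕ adjoint transporters by ✓`conj_cRec` ∕ ✓`inner_RRec_left`; my ✓`iota_H1OfRecordAt`).
* §2 (slot (c), `Δ₁ := π†(Δ+Δ⁽²⁾)π`, (g1) from (g5) by def-Y ✓`hessOpOfRecord128_gaugeMode`): ★★ `RDstar_iota_frakAOfRecordAtBg128_eq_zero` («`RD*(𝔄V) = 0`» — RR-2's `H1LandauTok` content),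
  ★★★ `RDstar_iota_Emap_H1OfRecordAtBg128_eq_zero` (THE F-H ROW for the chart `T47 H C ε` with `H := H1OfRecordAtBg128 … G′ Δ⁽²⁾′ …`, on `‖A′‖ < a_C` under that chart's Sect. C regime:
  `RD*(Emap H C ε A′) = RD*(H(C(T47A′))) = 0`, lit ✓`Emap_eq_H`), `hessOpOfRecord128_isSymmetric_zero` (`π†Δπ` symmetric at every background, ✓`hessOpOfRecord_isSymmetric`).

## Honest labels

Bookkeeping over def-Y's constructed letters and lit's (3.124)′; displayed: (g5) «`G′(Δλ) = λ` on `N(Q′♭)`», (g2) «`Q(U₀)(D_{U₀}λ) = 0` on `N(Q′♭)`» (def-Y's G′-datum ∕ averaging rows), symmetry of `Δ+Δ⁽²⁾`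
(`HessSymmTok`).  NOT for `H₁♭` (whose `Δ₁` is the bare `Δ(U₀)`: (g1) fails off the flat locus — that is F-H).  Nothing of Bałaban's estimates proved; K0ᴬ ⟨27238⟩ NOT closed; N07 NOT discharged;
COUNT∕K UNMOVED; R4 is the conditional finite-𝕋⁴ rung `BalabanLadder.UV` only; finite torus at fixed `ε` — nothing continuum ∕ OS ∕ Clay.  **The Yang–Mills mass gap is NOT proved by any of this.**
No `sorry`, no `def`, no `instance ∕ notation ∕ set_option`; standard axioms.
[cite: Balaban1985Variational, (45) p.285, (76) p.289, (102)–(103) p.293; Balaban1985BackgroundPropagators, (3.124) p.420, (3.126) p.420, (3.119) p.419]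
-/

noncomputable section

open Set
open scoped Matrix Matrix.Norms.L2Operator InnerProductSpace ComplexConjugate

namespace Summit.QuantumFields.YangMills.Theorems.N07H1LandauRowAtRecord

open Literature.MathematicalPhysics.QuantumFieldTheory.Balaban1983to89
open Literature.MathematicalPhysics.QuantumFieldTheory.Balaban1983to89.T4Continuum (T4Family)
open Literature.MathematicalPhysics.QuantumFieldTheory.Balaban1983to89.Node00
open B11Eq103H1Complex
open B11Eq111FrakG (nabla115)
open B11Eq115Space (NegSize NegSup JetSup)
open B11Eq174Chart (Regime)
open B11Eq90V0GroupComposed (T47)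
open B11Eq80Current (Emap Emap_eq_H)
open Summit.QuantumFields.YangMills.Theorems.N07Row110AtRecord (iota_H1OfRecordAt)
open Summit.QuantumFields.YangMills.Theorems.N07HessOpOfRecordSymmetric (hessOpOfRecord_isSymmetric)

/-! ## §1  `RD*(H₁B) = 0` for a symmetric `Δ₁` killing the gauge modes -/

section Generic

variable (F : T4Family) (N : ℕ) [NeZero N] {K : ℕ} (k : ℕ) (Ω : ℕ → Set (Site (F.P K) 0)) (U₀ : GaugeField (F.P K) 0 (SU N))
  [Fact (0 < (F.L : ℝ))] [Fact (0 < (F.P K).eta k)] [Fact (0 < c0Rec F K k)] [Fact (∀ c, 0 < wBRec F K k c)]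
  (levB : PBond (F.P K) k → ℕ)
  (Δ₁ : BondL2K ℂ (F.P K).d (fun _ => (F.P K).sitesPerDir 0) (c0Rec F K k) (WRec N) →ₗ[ℂ]
    BondL2K ℂ (F.P K).d (fun _ => (F.P K).sitesPerDir 0) (c0Rec F K k) (WRec N)) (a : ℝ)
  (hpos : ∀ x, x ≠ 0 → 0 < RCLike.re ⟪x, laplaceAOfRecordAt F N k U₀ Δ₁ (QOfRecord F N k U₀) (QflatOfRecord F N k) a x⟫_ℂ)
  (hQ : Function.Surjective (QOfRecord F N k U₀))
  (ι : Space115Lit F N K k Ω U₀ ≃ₗ[ℂ] BondL2K ℂ (F.P K).d (fun _ => (F.P K).sitesPerDir 0) (c0Rec F K k) (WRec N))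
  (hι : ∀ y, ι y = (funEquiv (phiRec N) (fun _ : B9SectCLatticeCarrier.Bond (F.P K).d (fun _ => (F.P K).sitesPerDir 0) => c0Rec F K k)).symm
    (JetSup.equiv _ _ (nabla115 ((F.P K).eta k) (unitsOfRecord F N U₀)) y))

include hι in
omit [NeZero N] in
/-- ★★ **(45) 2nd row ∕ (3.124)′ AT THE RECORD: `R_r(D†(ι(H₁B))) = 0`** for `H₁ = H1OfRecordAt … Δ₁ …` with `Δ₁` symmetric, (g1) `Δ₁(D_{U₀}λ) = 0` and (g2) `Q(U₀)(D_{U₀}λ) = 0` on `N(Q′♭)`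
(lit ✓`h124'_RLatticeK` via ✓`H1LatticeK_eq`, `H₁ = G₁Q†K⁻¹`). [cite: Balaban1985Variational, (45) p.285; Balaban1985BackgroundPropagators, (3.124) p.420, (3.126) p.420] -/
theorem RDstar_iota_H1OfRecordAt_eq_zero (hΔ : Δ₁.IsSymmetric)
    (g1 : ∀ l : SiteL2K ℂ (F.P K).d (fun _ => (F.P K).sitesPerDir 0) (c0Rec F K k) (WRec N), QflatOfRecord F N k l = 0 →
      Δ₁ (covDerivL2K ℂ (c0Rec F K k) (cRec F K k) (RRec F N U₀) l) = 0)
    (g2 : ∀ l : SiteL2K ℂ (F.P K).d (fun _ => (F.P K).sitesPerDir 0) (c0Rec F K k) (WRec N), QflatOfRecord F N k l = 0 →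
      QOfRecord F N k U₀ (covDerivL2K ℂ (c0Rec F K k) (cRec F K k) (RRec F N U₀) l) = 0)
    (B : NegSize (F.L : ℝ) ((F.P K).eta k) levB 0 (Matrix (Fin N) (Fin N) ℂ)) :
    RrOfRecord F N k U₀ (QflatOfRecord F N k) (covDivL2K ℂ (c0Rec F K k) (cRec F K k) (SRec F N U₀)
      (ι (H1OfRecordAt F N K k Ω U₀ levB Δ₁ (QOfRecord F N k U₀) (QflatOfRecord F N k) a hpos hQ B))) = 0 := by
  rw [iota_H1OfRecordAt F N k Ω U₀ levB Δ₁ a hpos hQ ι hι B, H1LatticeK_eq, LinearMap.comp_apply, LinearMap.comp_apply]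
  exact B9Eq3124GaugeModes.h124'_RLatticeK hpos (conj_cRec F K k) (inner_RRec_left U₀) hΔ g1 g2 _

end Generic

/-! ## §2  Slot (c): `RD*(𝔄V) = 0` and the F-H row for the `π`-type charts -/

section SlotC

variable (F : T4Family) (N : ℕ) [NeZero N] {K : ℕ} (k : ℕ) (Ω : ℕ → Set (Site (F.P K) 0)) (U₀ : GaugeField (F.P K) 0 (SU N))
  [Fact (0 < (F.L : ℝ))] [Fact (0 < (F.P K).eta k)] [Fact (0 < c0Rec F K k)] [Fact (∀ c, 0 < wBRec F K k c)]
  (levB : PBond (F.P K) k → ℕ)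
  (Gp : SiteL2K ℂ (F.P K).d (fun _ => (F.P K).sitesPerDir 0) (c0Rec F K k) (WRec N) →ₗ[ℂ]
    SiteL2K ℂ (F.P K).d (fun _ => (F.P K).sitesPerDir 0) (c0Rec F K k) (WRec N))
  (Δ2 : BondL2K ℂ (F.P K).d (fun _ => (F.P K).sitesPerDir 0) (c0Rec F K k) (WRec N) →ₗ[ℂ]
    BondL2K ℂ (F.P K).d (fun _ => (F.P K).sitesPerDir 0) (c0Rec F K k) (WRec N)) (a : ℝ)
  (hposπ : ∀ x, x ≠ 0 → 0 < RCLike.re ⟪x, laplaceAOfRecordAt F N k U₀ (hessOpOfRecord128 F N k U₀ Gp (QflatOfRecord F N k) Δ2)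
    (QOfRecord F N k U₀) (QflatOfRecord F N k) a x⟫_ℂ)
  (hQ : Function.Surjective (QOfRecord F N k U₀))
  (ι : Space115Lit F N K k Ω U₀ ≃ₗ[ℂ] BondL2K ℂ (F.P K).d (fun _ => (F.P K).sitesPerDir 0) (c0Rec F K k) (WRec N))
  (hι : ∀ y, ι y = (funEquiv (phiRec N) (fun _ : B9SectCLatticeCarrier.Bond (F.P K).d (fun _ => (F.P K).sitesPerDir 0) => c0Rec F K k)).symm
    (JetSup.equiv _ _ (nabla115 ((F.P K).eta k) (unitsOfRecord F N U₀)) y))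
  (hsym : (hessOpOfRecord128 F N k U₀ Gp (QflatOfRecord F N k) Δ2).IsSymmetric)
  (g5 : ∀ l : SiteL2K ℂ (F.P K).d (fun _ => (F.P K).sitesPerDir 0) (c0Rec F K k) (WRec N), QflatOfRecord F N k l = 0 →
    Gp (covLaplaceSiteK (cRec F K k) (RRec F N U₀) (SRec F N U₀) l) = l)
  (g2 : ∀ l : SiteL2K ℂ (F.P K).d (fun _ => (F.P K).sitesPerDir 0) (c0Rec F K k) (WRec N), QflatOfRecord F N k l = 0 →
    QOfRecord F N k U₀ (covDerivL2K ℂ (c0Rec F K k) (cRec F K k) (RRec F N U₀) l) = 0)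

include hι hsym g5 g2 in
/-- ★★ **«`RD*(S.𝔄 V) = 0`» — THE LANDAU ROW OF `𝔄 = H₁B` FOR THE SLOT-(c) READER** (RR-2's `H1LandauTok` content): from (g5) (⟹ (g1) by def-Y ✓`hessOpOfRecord128_gaugeMode`), (g2), symmetry.
[cite: Balaban1985Variational, (45) p.285, (103) p.293; Balaban1985BackgroundPropagators, (3.124) p.420] -/
theorem RDstar_iota_frakAOfRecordAtBg128_eq_zero (V : GaugeField (F.P K) k (SU N)) :
    RrOfRecord F N k U₀ (QflatOfRecord F N k) (covDivL2K ℂ (c0Rec F K k) (cRec F K k) (SRec F N U₀)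
      (ι (frakAOfRecordAtBg128 F N K k Ω U₀ levB Gp Δ2 a hposπ hQ V))) = 0 :=
  RDstar_iota_H1OfRecordAt_eq_zero F N k Ω U₀ levB _ a hposπ hQ ι hι hsym (fun _ hl => hessOpOfRecord128_gaugeMode F N k U₀ Gp (QflatOfRecord F N k) Δ2 g5 hl) g2 _

include hι hsym g5 g2 in
omit [NeZero N] in
/-- ★★★ **THE F-H ROW FOR THE `π`-TYPE CHARTS**: for the chart `T47 H C ε` with `H := H1OfRecordAtBg128 … G′ Δ⁽²⁾ …` (print's `H_π` at `Δ⁽²⁾ := 0`), on `‖A′‖ < a_C` under that chart's Sect. C regime,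
`RD*(Emap H C ε A′) = RD*(H(C(T47 A′))) = 0` (lit ✓`Emap_eq_H` + §1). [cite: Balaban1985Variational, (45)–(47) p.285, (76) p.289; Balaban1985BackgroundPropagators, (3.124) p.420, (3.126) p.420] -/
theorem RDstar_iota_Emap_H1OfRecordAtBg128_eq_zero {𝒞 : Space115Lit F N K k Ω U₀ → NegSize (F.L : ℝ) ((F.P K).eta k) levB 0 (Matrix (Fin N) (Fin N) ℂ)}
    {εT b C₂ c₄ aC : ℝ} (RC : Regime (H1OfRecordAtBg128 F N K k Ω U₀ levB Gp Δ2 a hposπ hQ) 0 𝒞 b 0 C₂ c₄ 0 aC εT)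
    {A' : Space115Lit F N K k Ω U₀} (hA' : ‖A'‖ < aC) :
    RrOfRecord F N k U₀ (QflatOfRecord F N k) (covDivL2K ℂ (c0Rec F K k) (cRec F K k) (SRec F N U₀)
      (ι (Emap (H1OfRecordAtBg128 F N K k Ω U₀ levB Gp Δ2 a hposπ hQ) 𝒞 εT A'))) = 0 := by
  rw [Emap_eq_H RC hA']
  exact RDstar_iota_H1OfRecordAt_eq_zero F N k Ω U₀ levB _ a hposπ hQ ι hι hsym
    (fun _ hl => hessOpOfRecord128_gaugeMode F N k U₀ Gp (QflatOfRecord F N k) Δ2 g5 hl) g2 _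

omit [NeZero N] [Fact (0 < (F.L : ℝ))] [Fact (0 < (F.P K).eta k)] [Fact (∀ c, 0 < wBRec F K k c)] in
/-- `π†Δ(U₀)π` (the `Δ⁽²⁾ := 0` slot, print's `Δ_π`) is symmetric at every background (✓`hessOpOfRecord_isSymmetric`). [cite: Balaban1985BackgroundPropagators, (3.119) p.419, (3.10) p.392] -/
theorem hessOpOfRecord128_isSymmetric_zero {F' : Type*} [AddCommGroup F'] [Module ℂ F']
    (Gp' : SiteL2K ℂ (F.P K).d (fun _ => (F.P K).sitesPerDir 0) (c0Rec F K k) (WRec N) →ₗ[ℂ] SiteL2K ℂ (F.P K).d (fun _ => (F.P K).sitesPerDir 0) (c0Rec F K k) (WRec N))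
    (Q' : SiteL2K ℂ (F.P K).d (fun _ => (F.P K).sitesPerDir 0) (c0Rec F K k) (WRec N) →ₗ[ℂ] F') :
    (hessOpOfRecord128 F N k U₀ Gp' Q' 0).IsSymmetric := by
  intro x y
  simp only [hessOpOfRecord128, add_zero, LinearMap.comp_apply]
  rw [LinearMap.adjoint_inner_left, hessOpOfRecord_isSymmetric F N k U₀, ← LinearMap.adjoint_inner_right]

end SlotC

end Summit.QuantumFields.YangMills.Theorems.N07H1LandauRowAtRecord

end
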